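import Mathlib
import Literature.AlgebraicGeometry.Resolution.Henselization
import Literature.AlgebraicGeometry.Resolution.HenselizedFunctionFields
import Summits.ResolutionOfSingularities.ResolutionOfSingularities.Theorems.DefectlessFramesDefectlessFramesRTwist
import Summits.ResolutionOfSingularities.ResolutionOfSingularities.Theorems.DefectlessFramesDefectlessFramesRSmallAxis

/-!
# Pointwise axis drop below `p` implies the conclusion of `DefectlessFramesR` (crux stmt-ResolutionOfSingularities-17921)

Helper stub `stub_dfrFrameOfAxisDropAt` of the line `Sketch` (kernel analysis). At a rank-one zero-dimensional
place `O ⊇ k` (`k` perfect of characteristic `p`), if a hypersurface frame `(y; z; f)` is dominated by SOME frame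
`(y₂; z₂; f₂)` in general position whose axis order (root multiplicity of `z̄₂` in the axis polynomial
`f₂(ȳ₂, X)`) is `< p` and not larger than that of `(y; z; f)` — no integrality or separability being asked of
`(y₂; z₂; f₂)` — then the conclusion of the crux holds for `(y; z; f)`: the Nagata re-framing `stub_dfrTwist` turns
`(y₂; z₂; f₂)` into an integral separable frame in general position of the same axis order dominating it, and
`stub_dfrSmallAxis` (Hensel cluster budget + Ostrowski) gives the defect clause for axis order `< p`.
-/

namespace Summit.ResolutionOfSingularities.ResolutionOfSingularities.Theorems

open Literature.AlgebraicGeometry.Resolution IsLocalRing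

/-- **Pointwise axis drop below `p` implies the conclusion of `DefectlessFramesR`.** If the hypersurface frame
`(y; z; f)` at the rank-one zero-dimensional place `O ⊇ k` is dominated by a frame `(y₂; z₂; f₂)` in general
position of axis order `< p` and not larger than that of `(y; z; f)`, then `(y; z; f)` is dominated by an integral,
separable frame in general position of not larger axis order whose projection is defectless at every valuation of
an algebraic closure above `O`. Proof: re-frame `(y₂; z₂; f₂)` by `stub_dfrTwist` and apply `stub_dfrSmallAxis`.
[folklore] -/
theorem stub_dfrFrameOfAxisDropAt : ∀ p : ℕ, p.Prime → ∀ (k K : Type) [Field k] [CharP k p] [PerfectField k] [Field K] [Algebra k K], (⊤ : IntermediateField k K).FG → ∀ O : ValuationSubring K, ∀ hk : (∀ c : k, algebraMap k K c ∈ O), Nonempty O.valuation.RankOne → (∀ x ∈ O, ∃ f : Polynomial k, f ≠ 0 ∧ Polynomial.aeval x f ∈ O.nonunits) → let ρ : k →+* IsLocalRing.ResidueField O := (IsLocalRing.residue O).comp ((algebraMap k K).codRestrict O hk); let axis : (m : ℕ) → (Fin m → O) → MvPolynomial (Fin (m + 1)) k → Polynomial (IsLocalRing.ResidueField O) := fun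 _ w g => MvPolynomial.eval₂ (Polynomial.C.comp ρ) (Fin.snoc (fun j => Polynomial.C (IsLocalRing.residue O (w j))) Polynomial.X) g; ∀ (n : ℕ) (y : Fin n → O) (z : O) (f : MvPolynomial (Fin (n + 1)) k), AlgebraicIndependent k (fun i => (y i : K)) → IntermediateField.adjoin k (Set.range (fun i => (y i : K)) ∪ {(z : K)}) = ⊤ → Ideal.span {f} = RingHom.ker (MvPolynomial.aeval (Fin.snoc (fun i => (y i : K)) (z : K)) : MvPolynomial (Fin (n + 1)) k →ₐ[k] K) → f ≠ 0 → (∃ (y₂ : Fin n → O) (z₂ : O) (f₂ : MvPolynomial (Fin (n + 1)) k), AlgebraicIndependent k (fun i => (y₂ i : K)) ∧ IntermediateField.adjoin k (Set.range (fun i => (y₂ i : K)) ∪ {(z₂ : K)}) = ⊤ ∧ Ideal.span {f₂} = RingHom.ker (MvPolynomial.aeval (Fin.snoc (fun i => (y₂ i : K)) (z₂ : K)) : MvPolynomial (Fin (n + 1)) k →ₐ[k] K) ∧ f₂ ≠ 0 ∧ (∀ i, (y i : K) ∈ Algebra.adjoin k (Set.range (fun i => (y₂ i : K)) ∪ {(z₂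 : K)})) ∧ (z : K) ∈ Algebra.adjoin k (Set.range (fun i => (y₂ i : K)) ∪ {(z₂ : K)}) ∧ axis n y₂ f₂ ≠ 0 ∧ (axis n y₂ f₂).rootMultiplicity (IsLocalRing.residue O z₂) < p ∧ (axis n y f ≠ 0 → (axis n y₂ f₂).rootMultiplicity (IsLocalRing.residue O z₂) ≤ (axis n y f).rootMultiplicity (IsLocalRing.residue O z))) → ∃ (y' : Fin n → O) (z' : O) (f' : MvPolynomial (Fin (n + 1)) k), AlgebraicIndependent k (fun i => (y' i : K)) ∧ IsIntegral (Algebra.adjoin k (Set.range fun i => (y' i : K))) (z' : K) ∧ IntermediateField.adjoin k (Set.range (fun i => (y' i : K)) ∪ {(z' : K)}) = ⊤ ∧ Ideal.span {f'} = RingHom.ker (MvPolynomial.aeval (Fin.snoc (fun i => (y' i : K)) (z' : K)) : MvPolynomial (Fin (n + 1)) k →ₐ[k] K) ∧ (∀ i, (y i : K) ∈ Algebra.adjoin k (Set.range (fun i => (y' i : K)) ∪ {(z' : K)})) ∧ (z : K) ∈ Algebra.adjoin k (Set.range (fun i => (y' i : K)) ∪ {(z' : K)}) ∧ axis n y' f'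 ≠ 0 ∧ (axis n y f ≠ 0 → (axis n y' f').rootMultiplicity (IsLocalRing.residue O z') ≤ (axis n y f).rootMultiplicity (IsLocalRing.residue O z)) ∧ IsSeparable (IntermediateField.adjoin k (Set.range fun i => (y' i : K))) (z' : K) ∧ ∀ (Ω : Type) [Field Ω] [Algebra K Ω] [IsAlgClosure K Ω] (V : ValuationSubring Ω), V.comap (algebraMap K Ω) = O → let F : Subfield Ω := (IntermediateField.adjoin k (Set.range fun i => (y' i : K))).toSubfield.map (algebraMap K Ω); Literature.AlgebraicGeometry.Resolution.IsDefectlessExtension V (Literature.AlgebraicGeometry.Resolution.henselization V F) (Literature.AlgebraicGeometry.Resolution.henselization V F ⊔ (algebraMap K Ω).fieldRange) := by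
  intro p hp k K _ _ _ _ _ hfg O hk hR hZ ρ axis n y z f _ _ _ _ hex
  obtain ⟨y₂, z₂, f₂, hy₂, hadj₂, hker₂, hf₂, hdomy, hdomz, hax₂, hlt, hle⟩ := hex
  obtain ⟨y', z', f', h1, h2, h3, h4, h5, h6, h7, h8, h9⟩ :=
    stub_dfrTwist p hp k K hfg O hk hR hZ n y₂ z₂ f₂ hy₂ hadj₂ hker₂ hf₂
  have h8' : (axis n y' f').rootMultiplicity (IsLocalRing.residue O z') ≤
      (axis n y₂ f₂).rootMultiplicity (IsLocalRing.residue O z₂) := h8 hax₂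
  have hsub : Algebra.adjoin k (Set.range (fun i => (y₂ i : K)) ∪ {(z₂ : K)}) ≤
      Algebra.adjoin k (Set.range (fun i => (y' i : K)) ∪ {(z' : K)}) := by
    refine Algebra.adjoin_le ?_
    rintro x (⟨i, rfl⟩ | hx)
    · exact h5 i
    · rw [Set.mem_singleton_iff] at hx
      rw [hx]
      exact h6
  refine ⟨y', z', f', h1, h2, h3, h4, fun i => hsub (hdomy i), hsub hdomz, h7,
    fun hax => h8'.trans (hle hax), h9, fun Ω _ _ _ V hV => ?_⟩
  exact stub_dfrSmallAxis p hp k K hfg O hk hR hZ n y' z' f' h1 h2 h3 h4 h7 h9 (lt_of_le_of_lt h8' hlt) Ω V hV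

end Summit.ResolutionOfSingularities.ResolutionOfSingularities.Theorems
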